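import Mathlib

/-!
# Transport lemma of route `PercExchangeRateTransport` — the fence engine

Crux `Summit.CriticalPhenomena.PercolationContinuityZ3.Theses.PercExchangeRateTransport.TransportLemma`
(stmt-CriticalPhenomena-16063), line `corrector` (tree `Cruxes/TransportLemma/Lines/corrector.lean`, rev 2,
strategist planner-cstrat-stmt-CriticalPhenomena-16063-b1-0; landed by the line lead). This file is the shared,
percolation-free real-analysis engine of the line:

* `hasDerivWithinAt_along` — chain rule along a curve `r ↦ (γ r, r)` written with the two partial `deriv`s that
  occur in the exchange-rate hypothesis `|∂ₜΘ − a ∂ₚΘ| ≤ η ∂ₚΘ`;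
* `fence_antitoneOn` / `fence_monotoneOn` — THE FENCE LEMMA: along a curve with `γ' + a(γ,·) ≤ −η`
  (resp. `≥ η`) every `Θ` that is nondecreasing in `p` and satisfies the exchange inequality with slack `η` is
  antitone (resp. monotone) (`antitoneOn_of_hasDerivWithinAt_nonpos` + sign bookkeeping);
* `hasDerivWithinAt_of_cone` — two-sided uniform cone bounds give a derivative within a set;
* `pc_modulus`, `collar_moduli` — Heine–Cantor on `[lo,hi]` and on the two-sided closed collar
  `{(p,t) : t ∈ [lo,hi], |p − pc t| ≤ ρ}` (a continuous image of a compact rectangle): a bound and a uniform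
  modulus for the field `a`;
* `rightContinuity` — `q ↦ ⨅ n, Θ n q t` (an infimum of continuous nondecreasing functions) is right-continuous;
* `stub_fence` — the registered packaging of the two fence lemmas.

No percolation, no Literature facts; Mathlib only. Sources: Grimmett 1999 §3.2 (directional-derivative method of
Aizenman–Grimmett) for the idea of integrating the exchange inequality along tilted directions; the rest is calculus.
-/

namespace Summit.CriticalPhenomena.PercolationContinuityZ3.Theorems.TransportLemma

open Filter Topology Set

/-! ## The fence lemma -/

/-- Chain rule along a curve `r ↦ (γ r, r)`, written with the two partial `deriv`s that occur in
the exchange-rate hypothesis. -/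
theorem hasDerivWithinAt_along (Θ : ℝ → ℝ → ℝ) (γ : ℝ → ℝ) (γ' : ℝ) (S : Set ℝ) (s : ℝ)
    (hΘ : DifferentiableAt ℝ (fun x : ℝ × ℝ => Θ x.1 x.2) (γ s, s))
    (hγ : HasDerivWithinAt γ γ' S s) :
    HasDerivWithinAt (fun r => Θ (γ r) r)
      (deriv (fun q => Θ q s) (γ s) * γ' + deriv (fun r => Θ (γ s) r) s) S s := by
  set F : ℝ × ℝ → ℝ := fun x => Θ x.1 x.2 with hF
  have hFd : HasFDerivAt F (fderiv ℝ F (γ s, s)) (γ s, s) := hΘ.hasFDerivAt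
  have hc : HasDerivWithinAt (fun r => (γ r, r)) (γ', (1:ℝ)) S s :=
    hγ.prodMk (hasDerivWithinAt_id s S)
  have hcomp : HasDerivWithinAt (F ∘ fun r => (γ r, r)) (fderiv ℝ F (γ s, s) (γ', 1)) S s :=
    HasFDerivAt.comp_hasDerivWithinAt (f := fun r => (γ r, r)) s hFd hc
  have hp : HasDerivAt (fun q => Θ q s) (fderiv ℝ F (γ s, s) (1, 0)) (γ s) := by
    have h1 : HasDerivAt (fun q : ℝ => (q, s)) ((1:ℝ), (0:ℝ)) (γ s) :=
      (hasDerivAt_id _).prodMk (hasDerivAt_const _ _)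
    exact HasFDerivAt.comp_hasDerivAt (f := fun q : ℝ => (q, s)) (γ s) hFd h1
  have ht : HasDerivAt (fun r => Θ (γ s) r) (fderiv ℝ F (γ s, s) (0, 1)) s := by
    have h1 : HasDerivAt (fun r : ℝ => (γ s, r)) ((0:ℝ), (1:ℝ)) s :=
      (hasDerivAt_const _ _).prodMk (hasDerivAt_id _)
    exact HasFDerivAt.comp_hasDerivAt (f := fun r : ℝ => (γ s, r)) s hFd h1
  rw [hp.deriv, ht.deriv]
  have key : fderiv ℝ F (γ s, s) (γ', 1)
      = fderiv ℝ F (γ s, s) (1, 0) * γ' + fderiv ℝ F (γ s, s) (0, 1) := by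
    have e : ((γ', (1:ℝ)) : ℝ × ℝ) = γ' • ((1:ℝ), (0:ℝ)) + ((0:ℝ), (1:ℝ)) := by
      ext <;> simp
    rw [e, map_add, map_smul, smul_eq_mul]
    ring
  rw [← key]
  exact hcomp

/-- **Fence lemma, decreasing version.** Along a curve `γ` on `[s₀,s₁]` where `Θ` is
differentiable, nondecreasing in `p`, the exchange inequality with field `a` and slack `η` holds,
and `γ' + a(γ,·) ≤ −η`, the composite `s ↦ Θ (γ s) s` is antitone. -/
theorem fence_antitoneOn (Θ : ℝ → ℝ → ℝ) (a : ℝ → ℝ → ℝ) (γ γ' : ℝ → ℝ) (η s₀ s₁ : ℝ)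
    (hΘ : ∀ s ∈ Icc s₀ s₁, DifferentiableAt ℝ (fun x : ℝ × ℝ => Θ x.1 x.2) (γ s, s))
    (hmono : ∀ t, Monotone (fun p => Θ p t))
    (hγ : ∀ s ∈ Icc s₀ s₁, HasDerivWithinAt γ (γ' s) (Icc s₀ s₁) s)
    (hex : ∀ s ∈ Icc s₀ s₁,
      |deriv (fun r => Θ (γ s) r) s - a (γ s) s * deriv (fun q => Θ q s) (γ s)|
        ≤ η * deriv (fun q => Θ q s) (γ s))
    (hslope : ∀ s ∈ Icc s₀ s₁, γ' s + a (γ s) s ≤ -η) :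
    AntitoneOn (fun s => Θ (γ s) s) (Icc s₀ s₁) := by
  have hD : ∀ s ∈ Icc s₀ s₁, HasDerivWithinAt (fun r => Θ (γ r) r)
      (deriv (fun q => Θ q s) (γ s) * γ' s + deriv (fun r => Θ (γ s) r) s) (Icc s₀ s₁) s :=
    fun s hs => hasDerivWithinAt_along Θ γ (γ' s) (Icc s₀ s₁) s (hΘ s hs) (hγ s hs)
  apply antitoneOn_of_hasDerivWithinAt_nonpos (convex_Icc s₀ s₁)
    (f' := fun s => deriv (fun q => Θ q s) (γ s) * γ' s + deriv (fun r => Θ (γ s) r) s)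
  · exact fun s hs => (hD s hs).continuousWithinAt
  · intro s hs
    rw [interior_Icc] at hs ⊢
    exact (hD s (Ioo_subset_Icc_self hs)).mono Ioo_subset_Icc_self
  · intro s hs
    rw [interior_Icc] at hs
    have hs' : s ∈ Icc s₀ s₁ := Ioo_subset_Icc_self hs
    have hP : 0 ≤ deriv (fun q => Θ q s) (γ s) := (hmono s).deriv_nonneg
    have h1 := hex s hs'
    have h2 := hslope s hs'
    have h3 := (abs_le.1 h1).2
    nlinarith [mul_le_mul_of_nonneg_left h2 hP]

/-- **Fence lemma, increasing version** (`γ' + a(γ,·) ≥ η` ⇒ monotone). -/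
theorem fence_monotoneOn (Θ : ℝ → ℝ → ℝ) (a : ℝ → ℝ → ℝ) (γ γ' : ℝ → ℝ) (η s₀ s₁ : ℝ)
    (hΘ : ∀ s ∈ Icc s₀ s₁, DifferentiableAt ℝ (fun x : ℝ × ℝ => Θ x.1 x.2) (γ s, s))
    (hmono : ∀ t, Monotone (fun p => Θ p t))
    (hγ : ∀ s ∈ Icc s₀ s₁, HasDerivWithinAt γ (γ' s) (Icc s₀ s₁) s)
    (hex : ∀ s ∈ Icc s₀ s₁,
      |deriv (fun r => Θ (γ s) r) s - a (γ s) s * deriv (fun q => Θ q s) (γ s)|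
        ≤ η * deriv (fun q => Θ q s) (γ s))
    (hslope : ∀ s ∈ Icc s₀ s₁, η ≤ γ' s + a (γ s) s) :
    MonotoneOn (fun s => Θ (γ s) s) (Icc s₀ s₁) := by
  have hD : ∀ s ∈ Icc s₀ s₁, HasDerivWithinAt (fun r => Θ (γ r) r)
      (deriv (fun q => Θ q s) (γ s) * γ' s + deriv (fun r => Θ (γ s) r) s) (Icc s₀ s₁) s :=
    fun s hs => hasDerivWithinAt_along Θ γ (γ' s) (Icc s₀ s₁) s (hΘ s hs) (hγ s hs)
  apply monotoneOn_of_hasDerivWithinAt_nonneg (convex_Icc s₀ s₁)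
    (f' := fun s => deriv (fun q => Θ q s) (γ s) * γ' s + deriv (fun r => Θ (γ s) r) s)
  · exact fun s hs => (hD s hs).continuousWithinAt
  · intro s hs
    rw [interior_Icc] at hs ⊢
    exact (hD s (Ioo_subset_Icc_self hs)).mono Ioo_subset_Icc_self
  · intro s hs
    rw [interior_Icc] at hs
    have hs' : s ∈ Icc s₀ s₁ := Ioo_subset_Icc_self hs
    have hP : 0 ≤ deriv (fun q => Θ q s) (γ s) := (hmono s).deriv_nonneg
    have h1 := hex s hs'
    have h2 := hslope s hs'
    have h3 := (abs_le.1 h1).1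
    nlinarith [mul_le_mul_of_nonneg_left h2 hP]

/-! ## Cone ⇒ derivative; Heine–Cantor moduli -/

/-- Uniform two-sided cone bounds give the derivative within the set. -/
theorem hasDerivWithinAt_of_cone (pc : ℝ → ℝ) (S : Set ℝ) (t₀ c : ℝ)
    (h : ∀ η > (0:ℝ), ∃ τ > (0:ℝ), ∀ s ∈ S, |s - t₀| ≤ τ →
      |pc s - pc t₀ - c * (s - t₀)| ≤ η * |s - t₀|) :
    HasDerivWithinAt pc c S t₀ := by
  rw [hasDerivWithinAt_iff_isLittleO, Asymptotics.isLittleO_iff]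
  intro η hη
  obtain ⟨τ, hτ, hb⟩ := h η hη
  rw [eventually_nhdsWithin_iff, Metric.eventually_nhds_iff]
  refine ⟨τ, hτ, fun s hs hsS => ?_⟩
  have h1 := hb s hsS (by rw [Real.dist_eq] at hs; exact hs.le)
  simp only [Real.norm_eq_abs, smul_eq_mul]
  rwa [mul_comm (s - t₀) c]

/-- Uniform continuity of `pc` on `[lo,hi]`, in `ε–δ` form. -/
theorem pc_modulus (pc : ℝ → ℝ) (lo hi : ℝ) (hpc : ContinuousOn pc (Icc lo hi)) :
    ∀ κ > (0:ℝ), ∃ τ > (0:ℝ), ∀ t ∈ Icc lo hi, ∀ t' ∈ Icc lo hi, |t - t'| ≤ τ →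
      |pc t - pc t'| ≤ κ := by
  have hu : UniformContinuousOn pc (Icc lo hi) :=
    isCompact_Icc.uniformContinuousOn_of_continuous hpc
  rw [Metric.uniformContinuousOn_iff_le] at hu
  intro κ hκ
  obtain ⟨τ, hτ, h⟩ := hu κ hκ
  refine ⟨τ, hτ, fun t ht t' ht' htt' => ?_⟩
  have := h t ht t' ht' (by rw [Real.dist_eq]; exact htt')
  rwa [Real.dist_eq] at this

/-- Heine–Cantor on the two-sided closed collar (a continuous image of a compact rectangle):
a bound and a uniform modulus for `a`. -/
theorem collar_moduli (pc : ℝ → ℝ) (a : ℝ → ℝ → ℝ) (lo hi ρ : ℝ)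
    (hpc : ContinuousOn pc (Icc lo hi))
    (ha : ContinuousOn (fun x : ℝ × ℝ => a x.1 x.2)
      {x : ℝ × ℝ | x.2 ∈ Icc lo hi ∧ |x.1 - pc x.2| ≤ ρ}) :
    (∃ A : ℝ, ∀ t ∈ Icc lo hi, ∀ p : ℝ, |p - pc t| ≤ ρ → |a p t| ≤ A) ∧
    (∀ η > (0:ℝ), ∃ ω > (0:ℝ), ∀ t ∈ Icc lo hi, ∀ t' ∈ Icc lo hi, ∀ p p' : ℝ,
      |p - pc t| ≤ ρ → |p' - pc t'| ≤ ρ → |t - t'| ≤ ω → |p - p'| ≤ ω →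
      |a p t - a p' t'| ≤ η) := by
  set C : Set (ℝ × ℝ) := {x : ℝ × ℝ | x.2 ∈ Icc lo hi ∧ |x.1 - pc x.2| ≤ ρ} with hC
  set K : Set (ℝ × ℝ) := Icc lo hi ×ˢ Icc (-ρ) ρ with hK
  set φ : ℝ × ℝ → ℝ × ℝ := fun y => (pc y.1 + y.2, y.1) with hφ
  have hKc : IsCompact K := isCompact_Icc.prod isCompact_Icc
  have hφc : ContinuousOn φ K := by
    have h1 : ContinuousOn (fun y : ℝ × ℝ => pc y.1) K :=
      hpc.comp continuous_fst.continuousOn (fun y hy => hy.1)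
    exact ((h1.add continuous_snd.continuousOn).prodMk continuous_fst.continuousOn)
  have hCK : C = φ '' K := by
    ext x
    constructor
    · rintro ⟨hx2, hx1⟩
      refine ⟨(x.2, x.1 - pc x.2), ⟨hx2, ?_⟩, ?_⟩
      · exact abs_le.1 hx1
      · simp only [hφ]; ext <;> simp
    · rintro ⟨y, ⟨hy1, hy2⟩, rfl⟩
      refine ⟨hy1, ?_⟩
      show |pc y.1 + y.2 - pc y.1| ≤ ρ
      rw [add_sub_cancel_left]
      exact abs_le.2 hy2
  have hCc : IsCompact C := by rw [hCK]; exact hKc.image_of_continuousOn hφc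
  constructor
  · obtain ⟨A, hA⟩ := hCc.exists_bound_of_continuousOn ha
    refine ⟨A, fun t ht p hp => ?_⟩
    have := hA (p, t) ⟨ht, hp⟩
    simpa [Real.norm_eq_abs] using this
  · intro η hη
    have hu := hCc.uniformContinuousOn_of_continuous ha
    rw [Metric.uniformContinuousOn_iff_le] at hu
    obtain ⟨ω, hω, h⟩ := hu η hη
    refine ⟨ω, hω, fun t ht t' ht' p p' hp hp' htt hpp => ?_⟩
    have hd : dist ((p, t) : ℝ × ℝ) (p', t') ≤ ω := by
      rw [Prod.dist_eq, Real.dist_eq, Real.dist_eq]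
      exact max_le hpp htt
    have := h (p, t) ⟨ht, hp⟩ (p', t') ⟨ht', hp'⟩ hd
    rwa [Real.dist_eq] at this

/-! ## Right-continuity of the infimum level function -/

/-- Right-continuity of the infimum level function `q ↦ ⨅ n, Θ n q t` at interior points: an
infimum of continuous nondecreasing functions is upper semicontinuous and nondecreasing, hence
right-continuous. -/
theorem rightContinuity (Θ : ℕ → ℝ → ℝ → ℝ) (t : ℝ)
    (hcont : ∀ n, ContinuousOn (fun x : ℝ × ℝ => Θ n x.1 x.2) (Set.Ioo 0 1 ×ˢ Set.Ioo 0 1))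
    (hmp : ∀ n t, Monotone (fun p => Θ n p t))
    (hnn : ∀ n p t, 0 ≤ Θ n p t)
    (ht : t ∈ Set.Ioo (0 : ℝ) 1) :
    ∀ p ∈ Set.Ioo (0 : ℝ) 1,
      Tendsto (fun q => ⨅ n, Θ n q t) (𝓝[>] p) (𝓝 (⨅ n, Θ n p t)) := by
  intro p hp
  have bdd : ∀ q : ℝ, BddBelow (Set.range fun n => Θ n q t) := fun q =>
    ⟨0, by rintro _ ⟨n, rfl⟩; exact hnn n q t⟩
  have hmonoF : ∀ q r : ℝ, q ≤ r → (⨅ n, Θ n q t) ≤ ⨅ n, Θ n r t := fun q r hqr =>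
    ciInf_mono (bdd q) fun n => hmp n t hqr
  rw [tendsto_order]
  refine ⟨fun b hb => ?_, fun b hb => ?_⟩
  · exact Filter.eventually_of_mem self_mem_nhdsWithin fun q hq =>
      lt_of_lt_of_le hb (hmonoF p q (le_of_lt hq))
  · obtain ⟨n₀, hn₀⟩ := exists_lt_of_ciInf_lt hb
    have hc : ContinuousAt (fun x : ℝ × ℝ => Θ n₀ x.1 x.2) (p, t) :=
      (hcont n₀).continuousAt (IsOpen.mem_nhds (isOpen_Ioo.prod isOpen_Ioo) ⟨hp, ht⟩)
    have hc' : ContinuousAt (fun q : ℝ => Θ n₀ q t) p :=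
      ContinuousAt.comp (g := fun x : ℝ × ℝ => Θ n₀ x.1 x.2) (f := fun q : ℝ => (q, t)) hc
        (by fun_prop : Continuous fun q : ℝ => (q, t)).continuousAt
    have hev : ∀ᶠ q in 𝓝 p, Θ n₀ q t < b := (tendsto_order.1 hc'.tendsto).2 b hn₀
    have hev' : ∀ᶠ q in 𝓝[>] p, Θ n₀ q t < b := hev.filter_mono nhdsWithin_le_nhds
    exact hev'.mono fun q hq => lt_of_le_of_lt (ciInf_le (bdd q) n₀) hq

/-- **stub_fence** (registered packaging of the fence lemma, both directions): along a curve `γ` on `[s₀,s₁]`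
where `Θ` is differentiable, nondecreasing in `p` and satisfies the exchange inequality with field `a` and slack
`η`, the composite `s ↦ Θ (γ s) s` is antitone if `γ' + a(γ,·) ≤ −η` and monotone if `γ' + a(γ,·) ≥ η`. -/
theorem stub_fence :
    ∀ (Θ : ℝ → ℝ → ℝ) (a : ℝ → ℝ → ℝ) (γ γ' : ℝ → ℝ) (η s₀ s₁ : ℝ),
      (∀ s ∈ Set.Icc s₀ s₁, DifferentiableAt ℝ (fun x : ℝ × ℝ => Θ x.1 x.2) (γ s, s)) →
      (∀ t, Monotone (fun p => Θ p t)) →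
      (∀ s ∈ Set.Icc s₀ s₁, HasDerivWithinAt γ (γ' s) (Set.Icc s₀ s₁) s) →
      (∀ s ∈ Set.Icc s₀ s₁,
        |deriv (fun r => Θ (γ s) r) s - a (γ s) s * deriv (fun q => Θ q s) (γ s)|
          ≤ η * deriv (fun q => Θ q s) (γ s)) →
      ((∀ s ∈ Set.Icc s₀ s₁, γ' s + a (γ s) s ≤ -η) → AntitoneOn (fun s => Θ (γ s) s) (Set.Icc s₀ s₁)) ∧
      ((∀ s ∈ Set.Icc s₀ s₁, η ≤ γ' s + a (γ s) s) → MonotoneOn (fun s => Θ (γ s) s) (Set.Icc s₀ s₁)) := by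
  intro Θ a γ γ' η s₀ s₁ hΘ hmono hγ hex
  exact ⟨fence_antitoneOn Θ a γ γ' η s₀ s₁ hΘ hmono hγ hex,
    fence_monotoneOn Θ a γ γ' η s₀ s₁ hΘ hmono hγ hex⟩

end Summit.CriticalPhenomena.PercolationContinuityZ3.Theorems.TransportLemma
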